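import Mathlib
import Summits.Ventures.PercRepro2.Defs
import Summits.Ventures.PercRepro2.Graph
import Summits.Ventures.PercRepro2.Events
import Summits.Ventures.PercRepro2.HCov

/-!
# The covariance form vanishes when `a₃` coincides with `a₂` or with `o`
(blind cell PercRepro2, mine-2 g15; MINE2-A3FIRST.md §2 — the contraction-into-mark cases of the
`a₃`-first induction, beside `RootCoincidence.Gc_a3_eq_a1` (`a₃ = a₁`) and `DiagBA3` (`a₃ = b`))

* `Gc_a3_eq_a2 : Gc p ends o a₁ a₂ a₂ b = 0` — `PD = Q ∩ {a₂ ∉ U} = ∅`, and every term of `Gc`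
  carries `D`, `D_o`, `PDb` or `PDbo`;
* `Gc_a3_eq_o : Gc p ends o a₁ a₂ o b = 0` — with `a₃ = o` the worlds are `T′ = Q ∩ {oL}`,
  `T = Q ∩ {oH}`, `PD = Q ∩ {o ∉ U}`, so `D_o = 0`, `PDbo = 0`, `EQb3 = EQb3o = EQbo`,
  `EQ3 = EQ3o = EQo` (`F = σ_o + σ₃(γ − ι_o) ≡ 0`), and the two brackets of `Gc` cancel.

Both identities hold for every weight vector and all vertices (no independence is used).
-/

namespace Summit.Ventures.PercRepro2
namespace A3Coincidence

open CovForm UnionCluster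

variable {V : Type*} {E : Type*} [Fintype E] [DecidableEq E] [DecidableEq V]
  {R : Type*} [Field R] [LinearOrder R] [IsStrictOrderedRing R]

/-! ## `a₃ = a₂` -/

omit [Fintype E] [DecidableEq E] [DecidableEq V] in
/-- `PD = ∅` when `a₃ = a₂` (then `a₃ ∈ C₂` always). -/
lemma PDEvent_a3_eq_a2 (ends : E → Sym2 V) (a₁ a₂ : V) : PDEvent ends a₁ a₂ a₂ = ∅ := by
  ext ω
  simp only [PDEvent, Dtilde, inU, Set.mem_inter_iff, Set.mem_compl_iff, Set.mem_union,
    mem_connEvent, Set.mem_empty_iff_false, iff_false, not_and, not_not]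
  intro _
  exact Or.inr (conn_refl ends ω a₂)

omit [DecidableEq V] [LinearOrder R] [IsStrictOrderedRing R] in
/-- **`Gc = 0` when `a₃ = a₂`.** -/
theorem Gc_a3_eq_a2 (p : E → R) (ends : E → Sym2 V) (o a₁ a₂ b : V) :
    Gc p ends o a₁ a₂ a₂ b = 0 := by
  unfold Gc DEF PDb PDbo Do
  simp only [PDEvent_a3_eq_a2, Set.empty_inter, prob_empty]
  ring

/-! ## `a₃ = o` -/

section A3EqO

omit [Fintype E] [DecidableEq E] [DecidableEq V] in
/-- `T′ = Q ∩ {oL}` when `a₃ = o`. -/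
lemma TEvent'_a3_eq_o (ends : E → Sym2 V) (o a₁ a₂ : V) :
    TEvent ends a₂ a₁ o = avoidAll ends a₂ {a₁} ∩ connEvent ends a₁ o := by
  ext ω
  simp only [TEvent, Set.mem_inter_iff, Set.mem_compl_iff, mem_connEvent, mem_avoidAll,
    Finset.mem_singleton, forall_eq]
  constructor
  · rintro ⟨h12, h1o⟩; exact ⟨fun h => h12 (conn_symm h), h1o⟩
  · rintro ⟨h21, h1o⟩; exact ⟨fun h => h21 (conn_symm h), h1o⟩

omit [Fintype E] [DecidableEq E] [DecidableEq V] in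
/-- `T = Q ∩ {oH}` when `a₃ = o`. -/
lemma TEvent_a3_eq_o (ends : E → Sym2 V) (o a₁ a₂ : V) :
    TEvent ends a₁ a₂ o = avoidAll ends a₂ {a₁} ∩ connEvent ends a₂ o := by
  ext ω
  simp only [TEvent, Set.mem_inter_iff, Set.mem_compl_iff, mem_connEvent, mem_avoidAll,
    Finset.mem_singleton, forall_eq]

omit [Fintype E] [DecidableEq E] [DecidableEq V] in
/-- `PD ∩ {x ↔ o} = ∅` for a root `x` when `a₃ = o` (`PD` has `o ∉ U`). -/
lemma PDEvent_a3_eq_o_inter_conn1 (ends : E → Sym2 V) (o a₁ a₂ : V) :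
    PDEvent ends a₁ a₂ o ∩ connEvent ends a₁ o = ∅ := by
  ext ω
  simp only [PDEvent, Dtilde, inU, Set.mem_inter_iff, Set.mem_compl_iff, Set.mem_union,
    mem_connEvent, Set.mem_empty_iff_false, iff_false]
  rintro ⟨⟨_, h2⟩, h1⟩
  exact h2 (Or.inl (conn_symm h1))

omit [Fintype E] [DecidableEq E] [DecidableEq V] in
/-- `PD ∩ {a₂ ↔ o} = ∅` when `a₃ = o`. -/
lemma PDEvent_a3_eq_o_inter_conn2 (ends : E → Sym2 V) (o a₁ a₂ : V) :
    PDEvent ends a₁ a₂ o ∩ connEvent ends a₂ o = ∅ := by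
  ext ω
  simp only [PDEvent, Dtilde, inU, Set.mem_inter_iff, Set.mem_compl_iff, Set.mem_union,
    mem_connEvent, Set.mem_empty_iff_false, iff_false]
  rintro ⟨⟨_, h2⟩, h1⟩
  exact h2 (Or.inr (conn_symm h1))

omit [Fintype E] [DecidableEq E] [DecidableEq V] in
/-- `PD ∩ ({a₁ ↔ o} ∩ X) = ∅` when `a₃ = o`. -/
lemma PDEvent_a3_eq_o_inter_inter_conn1 (ends : E → Sym2 V) (o a₁ a₂ : V) (X : Set (Config E)) :
    PDEvent ends a₁ a₂ o ∩ (connEvent ends a₁ o ∩ X) = ∅ := by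
  rw [← Set.inter_assoc, PDEvent_a3_eq_o_inter_conn1, Set.empty_inter]

omit [Fintype E] [DecidableEq E] [DecidableEq V] in
/-- `PD ∩ ({a₂ ↔ o} ∩ X) = ∅` when `a₃ = o`. -/
lemma PDEvent_a3_eq_o_inter_inter_conn2 (ends : E → Sym2 V) (o a₁ a₂ : V) (X : Set (Config E)) :
    PDEvent ends a₁ a₂ o ∩ (connEvent ends a₂ o ∩ X) = ∅ := by
  rw [← Set.inter_assoc, PDEvent_a3_eq_o_inter_conn2, Set.empty_inter]

omit [Fintype E] [DecidableEq E] [DecidableEq V] in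
/-- `(W ∩ {a₁ ↔ o}) ∩ ({a₁ ↔ o} ∩ X) = W ∩ ({a₁ ↔ o} ∩ X)`. -/
lemma inter_conn_inter_same (ends : E → Sym2 V) (W X : Set (Config E)) (u v : V) :
    W ∩ connEvent ends u v ∩ (connEvent ends u v ∩ X) = W ∩ (connEvent ends u v ∩ X) := by
  ext ω; simp only [Set.mem_inter_iff]; tauto

omit [Fintype E] [DecidableEq E] [DecidableEq V] in
/-- Under `Q`, `o` cannot be on both sides: `(Q ∩ {a₁ ↔ o}) ∩ ({a₂ ↔ o} ∩ X) = ∅`. -/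
lemma Q_conn1_inter_conn2 (ends : E → Sym2 V) (o a₁ a₂ : V) (X : Set (Config E)) :
    avoidAll ends a₂ {a₁} ∩ connEvent ends a₁ o ∩ (connEvent ends a₂ o ∩ X) = ∅ := by
  ext ω
  simp only [Set.mem_inter_iff, mem_avoidAll, Finset.mem_singleton, forall_eq, mem_connEvent,
    Set.mem_empty_iff_false, iff_false]
  rintro ⟨⟨h21, h1o⟩, h2o, _⟩
  exact h21 (conn_trans h2o (conn_symm h1o))

omit [Fintype E] [DecidableEq E] [DecidableEq V] in
/-- `(Q ∩ {a₂ ↔ o}) ∩ ({a₁ ↔ o} ∩ X) = ∅` under `Q`. -/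
lemma Q_conn2_inter_conn1 (ends : E → Sym2 V) (o a₁ a₂ : V) (X : Set (Config E)) :
    avoidAll ends a₂ {a₁} ∩ connEvent ends a₂ o ∩ (connEvent ends a₁ o ∩ X) = ∅ := by
  ext ω
  simp only [Set.mem_inter_iff, mem_avoidAll, Finset.mem_singleton, forall_eq, mem_connEvent,
    Set.mem_empty_iff_false, iff_false]
  rintro ⟨⟨h21, h2o⟩, h1o, _⟩
  exact h21 (conn_trans h2o (conn_symm h1o))

omit [Fintype E] [DecidableEq E] [DecidableEq V] in
/-- `(Q ∩ {a₁ ↔ o}) ∩ {a₁ ↔ o} = Q ∩ {a₁ ↔ o}`. -/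
lemma inter_conn_self (ends : E → Sym2 V) (W : Set (Config E)) (u v : V) :
    W ∩ connEvent ends u v ∩ connEvent ends u v = W ∩ connEvent ends u v := by
  rw [Set.inter_assoc, Set.inter_self]

omit [Fintype E] [DecidableEq E] [DecidableEq V] in
/-- `(Q ∩ {a₁ ↔ o}) ∩ {a₂ ↔ o} = ∅` under `Q`. -/
lemma Q_conn1_inter_conn2' (ends : E → Sym2 V) (o a₁ a₂ : V) :
    avoidAll ends a₂ {a₁} ∩ connEvent ends a₁ o ∩ connEvent ends a₂ o = ∅ := by
  ext ω
  simp only [Set.mem_inter_iff, mem_avoidAll, Finset.mem_singleton, forall_eq, mem_connEvent,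
    Set.mem_empty_iff_false, iff_false]
  rintro ⟨⟨h21, h1o⟩, h2o⟩
  exact h21 (conn_trans h2o (conn_symm h1o))

omit [Fintype E] [DecidableEq E] [DecidableEq V] in
/-- `(Q ∩ {a₂ ↔ o}) ∩ {a₁ ↔ o} = ∅` under `Q`. -/
lemma Q_conn2_inter_conn1' (ends : E → Sym2 V) (o a₁ a₂ : V) :
    avoidAll ends a₂ {a₁} ∩ connEvent ends a₂ o ∩ connEvent ends a₁ o = ∅ := by
  ext ω
  simp only [Set.mem_inter_iff, mem_avoidAll, Finset.mem_singleton, forall_eq, mem_connEvent,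
    Set.mem_empty_iff_false, iff_false]
  rintro ⟨⟨h21, h2o⟩, h1o⟩
  exact h21 (conn_trans h2o (conn_symm h1o))

end A3EqO

omit [DecidableEq V] in
/-- **`Gc = 0` when `a₃ = o`.** -/
theorem Gc_a3_eq_o (p : E → R) (ends : E → Sym2 V) (o a₁ a₂ b : V) :
    Gc p ends o a₁ a₂ o b = 0 := by
  unfold Gc DEF EQbo EQb3 EQb3o EQo EQ3 EQ3o PDb PDbo Do
  rw [gap_eq_Q]
  simp only [TEvent'_a3_eq_o ends o a₁ a₂, TEvent_a3_eq_o ends o a₁ a₂,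
    PDEvent_a3_eq_o_inter_conn1 ends o a₁ a₂, PDEvent_a3_eq_o_inter_conn2 ends o a₁ a₂,
    PDEvent_a3_eq_o_inter_inter_conn1 ends o a₁ a₂, PDEvent_a3_eq_o_inter_inter_conn2 ends o a₁ a₂,
    inter_conn_inter_same ends, Q_conn1_inter_conn2 ends o a₁ a₂, Q_conn2_inter_conn1 ends o a₁ a₂,
    inter_conn_self ends, Q_conn1_inter_conn2' ends o a₁ a₂, Q_conn2_inter_conn1' ends o a₁ a₂,
    prob_empty]
  ring

end A3Coincidence
end Summit.Ventures.PercRepro2
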